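import Summits.QuantumFields.YangMills.Theorems.BalabanLadderROTTiltBoundaryDecay
import Summits.QuantumFields.YangMills.Theorems.BalabanLadderROTRevisions
import HarnessLib

/-!
# Crux `ROT` (stmt-QuantumFields-20042): the split after the tilt half — `ROT` rev 2′ ⇐ N-ROT.3 ∧ boundary-influence decay

Helper file of the fleet lead `ym-spine-20042-p1` (generation g4), `--supports stmt-QuantumFields-20042` (count-neutral).  Closers by name
over the series p480022 → p481311 → p484329 → `…TiltBoundaryDecay` (`tiltInsensitivityOn_of_boundaryDecay`).

* `ti_of_boundaryDecay` — the guarded tilt half `TI t.tiltCell (fittedClass t.q)` of the recorded split v5″ (`…ROTTiltSplit`, p469977) from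
  the boundary-decay input posited for every `(G, r, a)` (the guards `MomentBounds6`, `GapInUnits` of `TI` are not used: the input is of
  mass-gap strength and stands on its own);
* `kingOnClass_of_nrot3_of_boundaryDecay`, `rotRev2'_of_nrot3_of_boundaryDecay` — hence the candidate stub `KingOnClass` (v5′/v6 of record)
  and the rotation leg of record for R85, `ROTRev2'`, from **N-ROT.3 at King's data** (`NROT3 king345.tiltCell (arcsin 3/5) (fittedClass 5)`,
  the two-regularisation comparison, leg 1, XL, unprinted) **and the boundary-decay input** (IR).

READING (census, numbers not adjectives): after this file the typed open content of `ROT` rev 2′ is `NROT3(S₅)` plus ONE infrared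
hypothesis stated in the tree's `kerE` vocabulary; 0 lines of either are claimed here.  No definition, no sorry.
-/

set_option autoImplicit false

noncomputable section

open MeasureTheory Filter Topology
open Literature.MathematicalPhysics.QuantumFieldTheory Literature.MathematicalPhysics.QuantumLattice
open Summit.QuantumFields.YangMills.Cruxes.OSLegsFromFemtoAndGap.DlrCollarTransfer
open Summit.QuantumFields.YangMills.Cruxes.OSLegsAtWeakCouplingC.Y2Bridge

namespace Summit.QuantumFields.YangMills.Theorems.ROT

open PythTriple

/-- **`TI ⇐ boundary-influence decay`** (for the tilt cells of any Pythagorean triple on its fitted class): if for every compact simple `G`,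
every `r` and every unit map `a` the lattice Yang–Mills cube kernels forget their boundary condition at the exponential rate `c₆ a(β)` per
unit depth (`β ≥ β₆`, volume factor `b⁴`, bounded continuous cylinder observables), then `TI t.tiltCell (fittedClass t.q)`. -/
theorem ti_of_boundaryDecay (t : PythTriple)
    (hBD : ∀ (G : Type) [Group G] [TopologicalSpace G] [IsTopologicalGroup G] [CompactSpace G],
      IsCompactSimpleLieGroup G → letI : MeasurableSpace G := borel G; haveI : BorelSpace G := ⟨rfl⟩;
      ∀ (r : LatticeRep G) (a : ℝ → ℝ), ∃ (c₆ β₆ K₆ : ℝ), 0 < c₆ ∧ ∀ β : ℝ, β₆ ≤ β →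
        ∀ (c : Fin 4 → ℤ) (b d : ℕ) (η η' : LGConfig 4 G) (A : LGConfig 4 G → ℝ) (M : ℝ)
          (S : Finset (Literature.MathematicalPhysics.QuantumLattice.ZdEdge 4)),
          Continuous A → (∀ U, |A U| ≤ M) → IsCylinder A S → (∀ e ∈ S, d ≤ depth c b e.1) →
          |kerE G r β c b η A - kerE G r β c b η' A| ≤ K₆ * M * (b : ℝ) ^ 4 * Real.exp (-(c₆ * a β * d))) :
    TI t.tiltCell (fittedClass t.q) := by
  intro G _ _ _ _ hG
  letI : MeasurableSpace G := borel G
  haveI : BorelSpace G := ⟨rfl⟩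
  intro r a _ _ _ _
  exact tiltInsensitivityOn_of_boundaryDecay t r a (hBD G hG r a)

/-- **`KingOnClass ⇐ N-ROT.3 (King's data) ∧ boundary-influence decay`**: the candidate stub of record for `ROT` rev 2′ from the
two-regularisation comparison at `θ = arcsin (3/5)` on the fitted class of `5` and the infrared input. -/
theorem kingOnClass_of_nrot3_of_boundaryDecay (h3 : NROT3 king345.tiltCell (Real.arcsin (3 / 5)) (fittedClass 5))
    (hBD : ∀ (G : Type) [Group G] [TopologicalSpace G] [IsTopologicalGroup G] [CompactSpace G],
      IsCompactSimpleLieGroup G → letI : MeasurableSpace G := borel G; haveI : BorelSpace G := ⟨rfl⟩;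
      ∀ (r : LatticeRep G) (a : ℝ → ℝ), ∃ (c₆ β₆ K₆ : ℝ), 0 < c₆ ∧ ∀ β : ℝ, β₆ ≤ β →
        ∀ (c : Fin 4 → ℤ) (b d : ℕ) (η η' : LGConfig 4 G) (A : LGConfig 4 G → ℝ) (M : ℝ)
          (S : Finset (Literature.MathematicalPhysics.QuantumLattice.ZdEdge 4)),
          Continuous A → (∀ U, |A U| ≤ M) → IsCylinder A S → (∀ e ∈ S, d ≤ depth c b e.1) →
          |kerE G r β c b η A - kerE G r β c b η' A| ≤ K₆ * M * (b : ℝ) ^ 4 * Real.exp (-(c₆ * a β * d))) :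
    KingOnClass :=
  kingOnClass_of_tilt345 h3 (ti_of_boundaryDecay king345 hBD)

/-- **`ROT` rev 2′ (text of record for R85) ⇐ N-ROT.3 (King's data) ∧ boundary-influence decay.**  The rotation leg in its rev-2′ form
`ROTRev2'` from the two-regularisation comparison on King's class and the infrared input, through `rotRev2'_of_tilt345`. -/
theorem rotRev2'_of_nrot3_of_boundaryDecay (h3 : NROT3 king345.tiltCell (Real.arcsin (3 / 5)) (fittedClass 5))
    (hBD : ∀ (G : Type) [Group G] [TopologicalSpace G] [IsTopologicalGroup G] [CompactSpace G],
      IsCompactSimpleLieGroup G → letI : MeasurableSpace G := borel G; haveI : BorelSpace G := ⟨rfl⟩;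
      ∀ (r : LatticeRep G) (a : ℝ → ℝ), ∃ (c₆ β₆ K₆ : ℝ), 0 < c₆ ∧ ∀ β : ℝ, β₆ ≤ β →
        ∀ (c : Fin 4 → ℤ) (b d : ℕ) (η η' : LGConfig 4 G) (A : LGConfig 4 G → ℝ) (M : ℝ)
          (S : Finset (Literature.MathematicalPhysics.QuantumLattice.ZdEdge 4)),
          Continuous A → (∀ U, |A U| ≤ M) → IsCylinder A S → (∀ e ∈ S, d ≤ depth c b e.1) →
          |kerE G r β c b η A - kerE G r β c b η' A| ≤ K₆ * M * (b : ℝ) ^ 4 * Real.exp (-(c₆ * a β * d))) :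
    ROTRev2' :=
  rotRev2'_of_tilt345 h3 (ti_of_boundaryDecay king345 hBD)

end Summit.QuantumFields.YangMills.Theorems.ROT

end
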